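import Summits.ResolutionOfSingularities.ResolutionOfSingularities.Theorems.FrobeniusLadderFInjectiveMacaulayficationPointFixDimOneVariety
import Summits.ResolutionOfSingularities.ResolutionOfSingularities.Theorems.FrobeniusLadderFInjectiveMacaulayficationSliceableCentre
import HarnessLib

/-!
# (T1‴) of the (A′) route: the LocFix datum at a non-closed bad point of LOCAL DIMENSION ONE — UNCONDITIONAL, by the conductor
# blow-up of the one-dimensional local domain `𝒪_{X₁,η}` (already in the tree for ANY point of local dimension one:
# `PointFixDimOneVariety.h4Loc_of_dim_one_variety`, res-D-pv-019 AS res-L1-w45a-stub-7)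
# (crux `FInjectiveMacaulayfication` stmt-ResolutionOfSingularities-15315, chain w45a; res-L1-w45a-plan-1 R16.19 (2) / R16.20 (1) / R16.21 (3):
# the curve rung of door v31; def `LocFixAtNonClosedDimOne` = res-L1-w45a-stub-3's `…FCUnguardedLocDimLe3` text; seat res-L1-w45a-stub-1 g6)

[OURS · L1 W4.5a] Support file (`--supports stmt-ResolutionOfSingularities-15315 --as helper`); NOT a statement of any manuscript;
AI-written (AI review is weaker than expert review). No definitions, no named facts, no sorry.

THE POINT. Door v31 (plan-1 R16.19/R16.21) reduces FC″ in local dimension ≤ 3 to the residual `RelClosedSubsetFixPow` plus LocFix data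
at `η`: (T1′) for `2 ≤ dim 𝒪_η ≤ 3` (`FCUnguardedAprime.locFixAtNonClosed_of_facts`, Lipman + Cossart–Piltant) and (T1‴) for
`dim 𝒪_η = 1`. The latter needs NO named fact: `A := 𝒪_{X₁,η}` is a one-dimensional Noetherian local domain essentially of finite type
over `k`, its normalisation `B` is module-finite (E. Noether, `StalkNormalizationFinite.module_finite_integralClosure_stalk`), and the
blow-up of the conductor-type ideal `I := 𝔠·𝔪_A` (`𝔠 = Ann_A(B/A)`) has charts `A[I/c_j] ≅ B[IB/c_j]` whose local rings over
`𝔪_A` are discrete valuation rings, hence FULL (`PointFixDimOne.h4Loc_of_dim_one`, conductor route of res-L1-w45a-tri-2 F49/F50) — this is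
the tree theorem `PointFixDimOneVariety.h4Loc_of_dim_one_variety`, valid at EVERY point `b` with `dim 𝒪_b = 1`, closed or not, bad or
not. It returns even a PRIMARY datum (`√(c) = 𝔪_η`); the (A′) datum asks only `(c) ≤ 𝔪_η`.

* `locFixAprime_atNonClosed_dimOne` — the binders of `FCUnguardedAprime.LocFixAtNonClosed` VERBATIM with the two dimension guards
  replaced by `ringKrullDim 𝒪_η = 1` (= res-L1-w45a-stub-3's def `LocFixAtNonClosedDimOne`), conclusion `LocFixData` unfolded; the
  hypotheses «separated / quasi-compact / `4 ≤ dim X₁` / CM stalks / `η` non-closed / `η` bad / generizations good» are idle.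
* `pointFix_atNonClosed_dimOne` — the same with the PRIMARY conclusion `√(c) = 𝔪_η` (for the record).
[folklore assembly]
-/

-- single-problem summit: the doubled namespace component is forced
set_option linter.dupNamespace false

noncomputable section

open AlgebraicGeometry CategoryTheory Literature.AlgebraicGeometry.Resolution TopologicalSpace IsLocalRing

namespace Summit.ResolutionOfSingularities.ResolutionOfSingularities.Theorems.FInjectiveMacaulayfication.LocFixAtNonClosedDimOne

open Summit.ResolutionOfSingularities.ResolutionOfSingularities.Theorems.FInjectiveMacaulayfication

/-- **(T1‴), PRIMARY form**: at every point `η` of local dimension one of an integral `X₁` locally of finite type over a field of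
characteristic `p` there is a PRIMARY point-fix datum — `(c) ≠ ⊥`, `√(c) = 𝔪_η`, every chart prime over `𝔪_η` FULL — with the door's
idle hypotheses carried. (= `PointFixDimOneVariety.h4Loc_of_dim_one_variety`.) [folklore; conductor blow-up] -/
theorem pointFix_atNonClosed_dimOne :
    ∀ (p : ℕ), p.Prime → ∀ (k : Type) [Field k] [CharP k p]
    (X₁ : Scheme.{0}) (f₁ : X₁ ⟶ Spec (.of k)),
      IsSeparated f₁ → LocallyOfFiniteType f₁ → QuasiCompact f₁ → IsIntegral X₁ → 4 ≤ topologicalKrullDim X₁ →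
      (∀ x : X₁, SliceableCentre.CMCl (X₁.presheaf.stalk x)) →
      ∀ η : X₁, ¬ IsClosed ({η} : Set X₁) → ¬ SliceableCentre.FCl p (X₁.presheaf.stalk η) →
        ringKrullDim (X₁.presheaf.stalk η) = 1 →
        (∀ y : X₁, y ⤳ η → y ≠ η → SliceableCentre.FCl p (X₁.presheaf.stalk y)) →
        ∃ (n' : ℕ) (c' : Fin n' → X₁.presheaf.stalk η),
      Ideal.span (Set.range c') ≠ ⊥ ∧ (Ideal.span (Set.range c')).radical = maximalIdeal (X₁.presheaf.stalk η) ∧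
        ∀ (j : Fin n') (𝔔 : PrimeSpectrum (blowupAlgebra (Ideal.span (Set.range c')) (c' j))),
          𝔔.asIdeal.comap (algebraMap (X₁.presheaf.stalk η) (blowupAlgebra (Ideal.span (Set.range c')) (c' j))) =
            maximalIdeal (X₁.presheaf.stalk η) → SliceableCentre.FullCl p (Localization.AtPrime 𝔔.asIdeal) := by
  intro p hp k _ _ X₁ f₁ _ hft _ hint _ _ η _ _ hdim _
  haveI := hft
  haveI := hint
  exact PointFixDimOneVariety.h4Loc_of_dim_one_variety p hp k X₁ f₁ η hdim

/-- **(T1‴) the (A′) LocFix datum at a non-closed bad point of LOCAL DIMENSION ONE — UNCONDITIONAL.** The binders of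
`FCUnguardedAprime.LocFixAtNonClosed` VERBATIM with `2 ≤ ringKrullDim 𝒪_η → ringKrullDim 𝒪_η ≤ 3 →` replaced by `ringKrullDim 𝒪_η = 1 →`
(= res-L1-w45a-stub-3's `LocFixAtNonClosedDimOne`), conclusion `LocFixData` unfolded: `(c′) ≠ ⊥`, `(c′) ≤ 𝔪_η`, every prime of every
chart `𝒪_η[(c′)/c′ⱼ]` over `𝔪_η` FULL. From the primary form (`(c′) ≤ √(c′) = 𝔪_η`). [folklore; conductor blow-up] -/
theorem locFixAprime_atNonClosed_dimOne :
    ∀ (p : ℕ), p.Prime → ∀ (k : Type) [Field k] [CharP k p]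
    (X₁ : Scheme.{0}) (f₁ : X₁ ⟶ Spec (.of k)),
      IsSeparated f₁ → LocallyOfFiniteType f₁ → QuasiCompact f₁ → IsIntegral X₁ → 4 ≤ topologicalKrullDim X₁ →
      (∀ x : X₁, SliceableCentre.CMCl (X₁.presheaf.stalk x)) →
      ∀ η : X₁, ¬ IsClosed ({η} : Set X₁) → ¬ SliceableCentre.FCl p (X₁.presheaf.stalk η) →
        ringKrullDim (X₁.presheaf.stalk η) = 1 →
        (∀ y : X₁, y ⤳ η → y ≠ η → SliceableCentre.FCl p (X₁.presheaf.stalk y)) →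
        ∃ (n' : ℕ) (c' : Fin n' → X₁.presheaf.stalk η),
      Ideal.span (Set.range c') ≠ ⊥ ∧ Ideal.span (Set.range c') ≤ maximalIdeal (X₁.presheaf.stalk η) ∧
        ∀ (j : Fin n') (𝔔 : PrimeSpectrum (blowupAlgebra (Ideal.span (Set.range c')) (c' j))),
          𝔔.asIdeal.comap (algebraMap (X₁.presheaf.stalk η) (blowupAlgebra (Ideal.span (Set.range c')) (c' j))) =
            maximalIdeal (X₁.presheaf.stalk η) → SliceableCentre.FullCl p (Localization.AtPrime 𝔔.asIdeal) := by
  intro p hp k _ _ X₁ f₁ hs hft hqc hint h4 hCM η hη hbad hdim hgen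
  obtain ⟨n, c, hne, hrad, hcharts⟩ := pointFix_atNonClosed_dimOne p hp k X₁ f₁ hs hft hqc hint h4 hCM η hη hbad hdim hgen
  exact ⟨n, c, hne, hrad ▸ Ideal.le_radical, hcharts⟩

end Summit.ResolutionOfSingularities.ResolutionOfSingularities.Theorems.FInjectiveMacaulayfication.LocFixAtNonClosedDimOne

end
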